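import Summits.AtomisticToContinuum.HydrodynamicLimit.Theorems.AntiMazurCoboundariesCellForecastPressureDecayClusterTailRemoval
import Summits.AtomisticToContinuum.HydrodynamicLimit.Theorems.AntiMazurCoboundariesCellForecastPressureDecayClusterTailCharging
import HarnessLib

/-!
# S2e-3(A) · the short-time cluster tail, T1 piece 1: pathwise charging of a disturbed fresh pair
# (sub-goal `stub_clusterTail_freshPairHit_pathwise` of the registered sub-goal `stub_clusterTail_freshPairHit`
# of stub `stub_clusterTail`, crux line `enskog-compensator-martingale`, crux `CellForecastPressureDecay`,
# stmt-AtomisticToContinuum-13915)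

The deterministic input of the bound `E #{disturbed fresh pairs} ≤ C L³ Δ²` (T1 term of the short-time cluster
tail): along the whole-cell flow of `m + 2` spheres, let the ordered pair `(i, j)`, `j = i.succAbove j'`, collide at a
time `s ≤ Δ` while both were free on `(0, s)` (a FRESH pair), and let `i` or `j` collide with a third sphere at some
time of `(0, Δ]`. Then

* the initial relative data `(xᵢ − xⱼ, vᵢ − vⱼ)` lie in Boltzmann's collision cylinder of the slab
  (`stub_kinematicAssembly_freshPair` + `pairHits_of_contact`), and
* at the FIRST time `T ∈ (s, Δ]` at which `i` or `j` meets an outsider, the pair has been collision-closed on `(0, T)`,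
  so the other `m` spheres ("the bath") followed the `m`-sphere flow of their own initial data (`comp_eq_of_isolated`,
  piece S2e(A)) while the pair followed the explicit two-body motion: free flights, the elastic jump `reflectVel` at
  `s = pairHitTime`, then free flights with the outgoing velocities (no recollision, `not_participates_after`); charging
  the contact at `T` to the cylinder of a fine grid time `a = ℓ Δ/M ∈ (s, T)` (`cylRel_of_affine_contact`,
  `eventually_exists_grid`, piece S2e(B)) exhibits, for all large `M`, a grid index `ℓ < M` and a bath label `c` such
  that the EXPLICIT extrapolated two-body state of `i` (or of `j`) at time `ℓΔ/M`, relative to the bath sphere `c` at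
  that time, lies in the cylinder of length `Δ/M`.

This is the pathwise half of the T1 estimate; the other half integrates the resulting measurable majorant (double
insertion, translation invariance of the tagged positions, energy conservation of the bath).

References: Gallagher–Saint-Raymond–Texier 2013, §4.1; Cercignani–Illner–Pulvirenti 1994, §2.2, §4.2, App. 4.A.
-/

noncomputable section

open MeasureTheory ProbabilityTheory Set Filter Topology
open scoped ENNReal BigOperators InnerProductSpace
open Literature.Analysis.FluidPDE Literature.MathematicalPhysics.KineticTheory

namespace Summit.AtomisticToContinuum.HydrodynamicLimit.Theorems.EnskogCompensator

/-! ## The labels other than a tagged ordered pair -/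

section Labels

variable {m : ℕ}

/-- The labels other than `i` and `i.succAbove j'` are enumerated by `c ↦ i.succAbove (j'.succAbove c)`. [folklore] -/
theorem range_succAbove_succAbove (i : Fin (m + 2)) (j' : Fin (m + 1)) :
    Set.range (fun c : Fin m => i.succAbove (j'.succAbove c)) = ({i, i.succAbove j'} : Set (Fin (m + 2)))ᶜ := by
  ext x
  simp only [Set.mem_range, Set.mem_compl_iff, Set.mem_insert_iff, Set.mem_singleton_iff, not_or]
  constructor
  · rintro ⟨c, rfl⟩
    exact ⟨Fin.succAbove_ne i _, fun h => Fin.succAbove_ne j' c (Fin.succAbove_right_injective h)⟩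
  · rintro ⟨hxi, hxj⟩
    obtain ⟨y, rfl⟩ := Fin.exists_succAbove_eq hxi
    have hy : y ≠ j' := fun h => hxj (h ▸ rfl)
    obtain ⟨c, rfl⟩ := Fin.exists_succAbove_eq hy
    exact ⟨c, rfl⟩

/-- The enumeration `c ↦ i.succAbove (j'.succAbove c)` is injective. [folklore] -/
theorem injective_succAbove_succAbove (i : Fin (m + 2)) (j' : Fin (m + 1)) :
    Function.Injective (fun c : Fin m => i.succAbove (j'.succAbove c)) :=
  Fin.succAbove_right_injective.comp Fin.succAbove_right_injective

end Labels

/-! ## The first outsider contact of a fresh pair -/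

section Pathwise

variable {σ : ℝ} {m : ℕ}

/-- **The first outsider contact.** Along the whole-cell flow of a good datum, if the fresh pair `(i, j)` collides at
`s ∈ (0, Δ]` and `i` or `j` collides with a sphere `∉ {i, j}` at a time of `(0, Δ]`, then there is a FIRST such time
`T ∈ (s, Δ]`, before which every collision of `i` is with `j` and conversely. [folklore] -/
theorem exists_first_outsider_contact (Ψ : Flows σ) {z : Cell (m + 2)} (hz : z ∈ (Ψ (m + 2)).good)
    {i j : Fin (m + 2)} (hij : i ≠ j) {Δ s : ℝ} (hs : s ∈ Set.Ioc 0 Δ)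
    (hcol : Collide (Euclidean.geometry (Fin 3)) σ ((Ψ (m + 2)).flow s z) i j)
    (hfresh : ∀ s' ∈ Set.Ioo 0 s, ¬ Participates (Euclidean.geometry (Fin 3)) σ ((Ψ (m + 2)).flow s' z) i ∧
      ¬ Participates (Euclidean.geometry (Fin 3)) σ ((Ψ (m + 2)).flow s' z) j)
    (hout : ∃ k, k ≠ i ∧ k ≠ j ∧ ∃ s' ∈ Set.Ioc 0 Δ, (Collide (Euclidean.geometry (Fin 3)) σ ((Ψ (m + 2)).flow s' z) i k ∨
      Collide (Euclidean.geometry (Fin 3)) σ ((Ψ (m + 2)).flow s' z) j k)) :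
    ∃ T ∈ Set.Ioc s Δ, (∃ k, k ≠ i ∧ k ≠ j ∧ (Collide (Euclidean.geometry (Fin 3)) σ ((Ψ (m + 2)).flow T z) i k ∨
        Collide (Euclidean.geometry (Fin 3)) σ ((Ψ (m + 2)).flow T z) j k)) ∧
      (∀ t ∈ Set.Ioo 0 T, ∀ k, Collide (Euclidean.geometry (Fin 3)) σ ((Ψ (m + 2)).flow t z) i k → k = j) ∧
      (∀ t ∈ Set.Ioo 0 T, ∀ k, Collide (Euclidean.geometry (Fin 3)) σ ((Ψ (m + 2)).flow t z) j k → k = i) := by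
  set G := Euclidean.geometry (Fin 3) with hG
  have htraj := (Ψ (m + 2)).isTrajectory z hz
  -- the ordered contact pairs at the fresh collision
  have hc : (Ψ (m + 2)).flow s z ∈ contactSet G (m + 2) σ i j := mem_contactSet_of_collide hcol
  have hpij : (i, j) ∈ contactPairs G σ ((Ψ (m + 2)).flow s z) := mem_contactPairs.2 ⟨hij, hc⟩
  have hpji : (j, i) ∈ contactPairs G σ ((Ψ (m + 2)).flow s z) :=
    mem_contactPairs.2 ⟨hij.symm, mem_contactSet_comm.1 hc⟩
  -- at time `s` the only partner of `i` is `j` and conversely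
  have hs_i : ∀ k, Collide G σ ((Ψ (m + 2)).flow s z) i k → k = j := fun k hk => htraj.eq_of_collide hpij hk
  have hs_j : ∀ k, Collide G σ ((Ψ (m + 2)).flow s z) j k → k = i := fun k hk => htraj.eq_of_collide hpji hk
  -- the set of outsider-contact times after `s`
  set S : Set ℝ := {t | s < t ∧ t ≤ Δ ∧ ∃ k, k ≠ i ∧ k ≠ j ∧
    (Collide G σ ((Ψ (m + 2)).flow t z) i k ∨ Collide G σ ((Ψ (m + 2)).flow t z) j k)} with hSdef
  have hSne : S.Nonempty := by
    obtain ⟨k, hki, hkj, s', hs', hk⟩ := hout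
    refine ⟨s', ?_, hs'.2, k, hki, hkj, hk⟩
    rcases lt_trichotomy s' s with hlt | heq | hgt
    · rcases hk with hk | hk
      · exact absurd ⟨k, hk⟩ (hfresh s' ⟨hs'.1, hlt⟩).1
      · exact absurd ⟨k, hk⟩ (hfresh s' ⟨hs'.1, hlt⟩).2
    · subst heq
      rcases hk with hk | hk
      · exact absurd (hs_i k hk) hkj
      · exact absurd (hs_j k hk) hki
    · exact hgt
  have hSfin : S.Finite := by
    refine (htraj.locFinite 0 Δ).subset fun t ht => ⟨?_, (hs.1.trans ht.1).le, ht.2.1⟩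
    obtain ⟨k, -, -, hk | hk⟩ := ht.2.2
    · exact mem_collisionTimes_iff_exists_participates.2 ⟨i, k, hk⟩
    · exact mem_collisionTimes_iff_exists_participates.2 ⟨j, k, hk⟩
  obtain ⟨T, hTS, hTmin⟩ := Set.exists_min_image S id hSfin hSne
  refine ⟨T, ⟨hTS.1, hTS.2.1⟩, hTS.2.2, fun t ht k hk => ?_, fun t ht k hk => ?_⟩
  · by_contra hkj
    rcases lt_trichotomy t s with hlt | rfl | hgt
    · exact (hfresh t ⟨ht.1, hlt⟩).1 ⟨k, hk⟩
    · exact hkj (hs_i k hk)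
    · have htS : t ∈ S := ⟨hgt, (ht.2.le.trans hTS.2.1), k, hk.ne.symm, hkj, Or.inl hk⟩
      exact (not_le.2 ht.2) (hTmin t htS)
  · by_contra hki
    rcases lt_trichotomy t s with hlt | rfl | hgt
    · exact (hfresh t ⟨ht.1, hlt⟩).2 ⟨k, hk⟩
    · exact hki (hs_j k hk)
    · have htS : t ∈ S := ⟨hgt, (ht.2.le.trans hTS.2.1), k, hki, hk.ne.symm, Or.inr hk⟩
      exact (not_le.2 ht.2) (hTmin t htS)


/-! ## The registered sub-goal -/

/-- **Registered sub-goal `stub_clusterTail_freshPairHit_pathwise`** (piece of the registered sub-goal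
`stub_clusterTail_freshPairHit`, S2e-3, of stub `stub_clusterTail` of the line `enskog-compensator-martingale`):
**pathwise charging of a disturbed fresh pair.** Along the whole-cell flow of a good datum `z` of `m + 2` spheres
whose bath `c ↦ z (i.succAbove (j'.succAbove c))` is a good datum of the `m`-sphere flow: if the ordered pair
`(i, i.succAbove j')` collides at a time `s ∈ (0, Δ]` while both were free on `(0, s)` and `i` or `i.succAbove j'`
collides with a third sphere at a time of `(0, Δ]`, then the initial relative data of the pair lie in the collision
cylinder of the slab, and for all fine enough meshes `Δ/M` some grid index `ℓ < M` and bath label `c` put the explicit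
two-body state of `i` or of `i.succAbove j'` at the grid time `ℓΔ/M` (position `y + τ w + (ℓΔ/M − τ) w'`, velocity `w'`,
`τ = pairHitTime`, `(wᵢ', wⱼ') = reflectVel (q + τ u) (wᵢ, wⱼ)`), relative to the time-`ℓΔ/M` state of the sphere `c` of
the `m`-sphere flow of the bath, in the collision cylinder of length `Δ/M`. [cite: GST2013, §4.1] -/
theorem stub_clusterTail_freshPairHit_pathwise : ∀ (σ : ℝ) (m : ℕ) (Ψ : Flows σ) (z : Cell (m + 2)) (i : Fin (m + 2))
    (j' : Fin (m + 1)) (Δ : ℝ), 0 < σ → z ∈ (Ψ (m + 2)).good → (fun c => z (i.succAbove (j'.succAbove c))) ∈ (Ψ m).good →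
    (∃ s ∈ Set.Ioc 0 Δ, Collide (Euclidean.geometry (Fin 3)) σ ((Ψ (m + 2)).flow s z) i (i.succAbove j') ∧
      (∀ s' ∈ Set.Ioo 0 s, ¬ Participates (Euclidean.geometry (Fin 3)) σ ((Ψ (m + 2)).flow s' z) i ∧
        ¬ Participates (Euclidean.geometry (Fin 3)) σ ((Ψ (m + 2)).flow s' z) (i.succAbove j')) ∧
      ∃ k, k ≠ i ∧ k ≠ i.succAbove j' ∧ ∃ s' ∈ Set.Ioc 0 Δ,
        (Collide (Euclidean.geometry (Fin 3)) σ ((Ψ (m + 2)).flow s' z) i k ∨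
          Collide (Euclidean.geometry (Fin 3)) σ ((Ψ (m + 2)).flow s' z) (i.succAbove j') k)) →
    (((z i).1 - (z (i.succAbove j')).1), ((z i).2 - (z (i.succAbove j')).2)) ∈
        {p : V3 × V3 | PairHits σ p.1 p.2 ∧ 0 < pairDisc σ p.1 p.2 ∧ pairHitTime σ p.1 p.2 ∈ Set.Ioc 0 Δ} ∧
      ∀ᶠ M : ℕ in Filter.atTop, ∃ ℓ : ℕ, ℓ < M ∧ ∃ c : Fin m,
        ((z i).1 + pairHitTime σ ((z i).1 - (z (i.succAbove j')).1) ((z i).2 - (z (i.succAbove j')).2) • (z i).2 +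
              ((ℓ : ℝ) * (Δ / M) - pairHitTime σ ((z i).1 - (z (i.succAbove j')).1) ((z i).2 - (z (i.succAbove j')).2)) •
                (reflectVel (((z i).1 - (z (i.succAbove j')).1) +
              pairHitTime σ ((z i).1 - (z (i.succAbove j')).1) ((z i).2 - (z (i.succAbove j')).2) • ((z i).2 - (z (i.succAbove j')).2))
              ((z i).2, (z (i.succAbove j')).2)).1 -
            ((Ψ m).flow ((ℓ : ℝ) * (Δ / M)) (fun c => z (i.succAbove (j'.succAbove c))) c).1,
          (reflectVel (((z i).1 - (z (i.succAbove j')).1) +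
              pairHitTime σ ((z i).1 - (z (i.succAbove j')).1) ((z i).2 - (z (i.succAbove j')).2) • ((z i).2 - (z (i.succAbove j')).2))
              ((z i).2, (z (i.succAbove j')).2)).1 -
            ((Ψ m).flow ((ℓ : ℝ) * (Δ / M)) (fun c => z (i.succAbove (j'.succAbove c))) c).2) ∈
            {p : V3 × V3 | PairHits σ p.1 p.2 ∧ 0 < pairDisc σ p.1 p.2 ∧ pairHitTime σ p.1 p.2 ∈ Set.Ioc 0 (Δ / M)} ∨
        ((z (i.succAbove j')).1 + pairHitTime σ ((z i).1 - (z (i.succAbove j')).1) ((z i).2 - (z (i.succAbove j')).2) • (z (i.succAbove j')).2 +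
              ((ℓ : ℝ) * (Δ / M) - pairHitTime σ ((z i).1 - (z (i.succAbove j')).1) ((z i).2 - (z (i.succAbove j')).2)) •
                (reflectVel (((z i).1 - (z (i.succAbove j')).1) +
              pairHitTime σ ((z i).1 - (z (i.succAbove j')).1) ((z i).2 - (z (i.succAbove j')).2) • ((z i).2 - (z (i.succAbove j')).2))
              ((z i).2, (z (i.succAbove j')).2)).2 -
            ((Ψ m).flow ((ℓ : ℝ) * (Δ / M)) (fun c => z (i.succAbove (j'.succAbove c))) c).1,
          (reflectVel (((z i).1 - (z (i.succAbove j')).1) +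
              pairHitTime σ ((z i).1 - (z (i.succAbove j')).1) ((z i).2 - (z (i.succAbove j')).2) • ((z i).2 - (z (i.succAbove j')).2))
              ((z i).2, (z (i.succAbove j')).2)).2 -
            ((Ψ m).flow ((ℓ : ℝ) * (Δ / M)) (fun c => z (i.succAbove (j'.succAbove c))) c).2) ∈
            {p : V3 × V3 | PairHits σ p.1 p.2 ∧ 0 < pairDisc σ p.1 p.2 ∧ pairHitTime σ p.1 p.2 ∈ Set.Ioc 0 (Δ / M)} := by
  intro σ m Ψ z i j' Δ hσ hz hz' hE
  have hij : i ≠ i.succAbove j' := (Fin.succAbove_ne i j').symm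
  have htraj := (Ψ (m + 2)).isTrajectory z hz
  obtain ⟨s, hs, hcol, hfresh, hout⟩ := hE
  have hc : (Ψ (m + 2)).flow s z ∈ contactSet (Euclidean.geometry (Fin 3)) (m + 2) σ i (i.succAbove j') :=
    mem_contactSet_of_collide hcol
  -- the fresh-pair kinematics
  obtain ⟨hnorm, hin, hfi, hfj, -, htime, -, -⟩ := stub_kinematicAssembly_freshPair σ (m + 2) Ψ z hz i
    (i.succAbove j') s hij hs.1 hc (fun s' hs' => (hfresh s' hs').1) (fun s' hs' => (hfresh s' hs').2)
  have hcyl : ((z i).1 - (z (i.succAbove j')).1, (z i).2 - (z (i.succAbove j')).2) ∈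
      {p : V3 × V3 | PairHits σ p.1 p.2 ∧ 0 < pairDisc σ p.1 p.2 ∧ pairHitTime σ p.1 p.2 ∈ Set.Ioc 0 Δ} :=
    pairHits_of_contact hσ hs hnorm hin
  refine ⟨hcyl, ?_⟩
  -- the first outsider contact `T`
  obtain ⟨T, hT, ⟨k₀, hk₀i, hk₀j, hk₀⟩, hiso_i, hiso_j⟩ :=
    exists_first_outsider_contact Ψ hz hij hs hcol hfresh hout
  have hsT : s < T := hT.1
  have hT0 : 0 < T := hs.1.trans hsT
  have hTΔ : T ≤ Δ := hT.2
  -- the bath follows the `m`-sphere flow on `[0, T)`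
  have hrem := (stub_clusterTail_removal σ m Ψ T).2 (m + 2) z (fun c => i.succAbove (j'.succAbove c)) i
    (i.succAbove j') (injective_succAbove_succAbove i j') (range_succAbove_succAbove i j') hz hz' hiso_i hiso_j
  -- the bath trajectory and a collision-free stretch before `T`
  have hη := (Ψ m).isTrajectory _ hz'
  obtain ⟨s₀, hs₀T, hfree₀⟩ := hη.exists_Ioo_left_free T
  -- the pair flies freely on `(s, T)` with the outgoing velocities
  have hnp := not_participates_after htraj hij hc (fun t ht => hiso_i t ⟨hs.1.trans ht.1, ht.2⟩)
    (fun t ht => hiso_j t ⟨hs.1.trans ht.1, ht.2⟩)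
  -- the grid
  have hg : 0 < min (T - s) (T - s₀) := lt_min (sub_pos.2 hsT) (sub_pos.2 hs₀T)
  filter_upwards [eventually_exists_grid hT0 hTΔ hg] with M ⟨ℓ, hℓM, haT, hTa, hga⟩
  have has : s < (ℓ : ℝ) * (Δ / M) := by
    have := min_le_left (T - s) (T - s₀)
    linarith
  have has₀ : s₀ < (ℓ : ℝ) * (Δ / M) := by
    have := min_le_right (T - s) (T - s₀)
    linarith
  have ha0 : 0 ≤ (ℓ : ℝ) * (Δ / M) := hs.1.le.trans has.le
  have hTah : T ≤ (ℓ : ℝ) * (Δ / M) + Δ / M := by linarith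
  refine ⟨ℓ, hℓM, ?_⟩
  -- affine motion of a tagged sphere on `[a, T)` that is free on `(s, T)`
  have haff : ∀ p : Fin (m + 2), (∀ t ∈ Set.Ioo s T, ¬ Participates (Euclidean.geometry (Fin 3)) σ ((Ψ (m + 2)).flow t z) p) →
      ((Ψ (m + 2)).flow s z p).1 = (z p).1 + s • (z p).2 →
      ∀ t ∈ Set.Ico ((ℓ : ℝ) * (Δ / M)) T, (Ψ (m + 2)).flow t z p =
        (((z p).1 + pairHitTime σ ((z i).1 - (z (i.succAbove j')).1) ((z i).2 - (z (i.succAbove j')).2) • (z p).2 +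
          ((ℓ : ℝ) * (Δ / M) - pairHitTime σ ((z i).1 - (z (i.succAbove j')).1) ((z i).2 - (z (i.succAbove j')).2)) •
            ((Ψ (m + 2)).flow s z p).2) + (t - (ℓ : ℝ) * (Δ / M)) • ((Ψ (m + 2)).flow s z p).2,
          ((Ψ (m + 2)).flow s z p).2) := by
    intro p hp hpos t ht
    have hst : s ≤ t := has.le.trans ht.1
    obtain ⟨h1, h2⟩ := stub_kinematicAssembly_noCollision σ (m + 2) Ψ z hz p s t hst
      (fun τ hτ => hp τ ⟨hτ.1, hτ.2.trans_lt ht.2⟩)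
    refine Prod.ext ?_ h2
    rw [h1, hpos, htime]
    have : (t - s) • ((Ψ (m + 2)).flow s z p).2 =
        ((ℓ : ℝ) * (Δ / M) - s) • ((Ψ (m + 2)).flow s z p).2 + (t - (ℓ : ℝ) * (Δ / M)) • ((Ψ (m + 2)).flow s z p).2 := by
      rw [← add_smul]; congr 1; ring
    rw [this]; abel
  have haff_i := haff i (fun t ht => (hnp t ht).1) (by rw [hfi])
  have haff_j := haff (i.succAbove j') (fun t ht => (hnp t ht).2) (by rw [hfj])
  -- affine motion of every bath sphere on `[a, T)`, in the `(m+2)`-flow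
  have haff_b : ∀ c, ∀ t ∈ Set.Ico ((ℓ : ℝ) * (Δ / M)) T, (Ψ (m + 2)).flow t z (i.succAbove (j'.succAbove c)) =
      ((((Ψ m).flow ((ℓ : ℝ) * (Δ / M)) (fun c => z (i.succAbove (j'.succAbove c)))) c).1 +
          (t - (ℓ : ℝ) * (Δ / M)) • (((Ψ m).flow ((ℓ : ℝ) * (Δ / M)) (fun c => z (i.succAbove (j'.succAbove c)))) c).2,
        (((Ψ m).flow ((ℓ : ℝ) * (Δ / M)) (fun c => z (i.succAbove (j'.succAbove c)))) c).2) := by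
    intro c t ht
    have h1 : (Ψ (m + 2)).flow t z (i.succAbove (j'.succAbove c)) =
        (Ψ m).flow t (fun c => z (i.succAbove (j'.succAbove c))) c :=
      congrFun (hrem t ⟨ha0.trans ht.1, ht.2⟩) c
    have h2 : (Ψ m).flow t (fun c => z (i.succAbove (j'.succAbove c))) =
        freeFlight (Euclidean.geometry (Fin 3)) (t - (ℓ : ℝ) * (Δ / M))
          ((Ψ m).flow ((ℓ : ℝ) * (Δ / M)) (fun c => z (i.succAbove (j'.succAbove c)))) :=
      hη.eq_freeFlight_of_Ioo_free (fun τ hτ => hfree₀ τ ⟨has₀.trans hτ.1, hτ.2⟩) ht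
    rw [h1, h2, freeFlight_apply]
    rfl
  -- the velocities at time `s` are the reflected ones
  have hvi : ((Ψ (m + 2)).flow s z i).2 =
      (reflectVel (((z i).1 - (z (i.succAbove j')).1) +
        pairHitTime σ ((z i).1 - (z (i.succAbove j')).1) ((z i).2 - (z (i.succAbove j')).2) • ((z i).2 - (z (i.succAbove j')).2))
        ((z i).2, (z (i.succAbove j')).2)).1 := by
    rw [hfi, htime]
  have hvj : ((Ψ (m + 2)).flow s z (i.succAbove j')).2 =
      (reflectVel (((z i).1 - (z (i.succAbove j')).1) +
        pairHitTime σ ((z i).1 - (z (i.succAbove j')).1) ((z i).2 - (z (i.succAbove j')).2) • ((z i).2 - (z (i.succAbove j')).2))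
        ((z i).2, (z (i.succAbove j')).2)).2 := by
    rw [hfj, htime]
  rw [hvi] at haff_i
  rw [hvj] at haff_j
  -- the outsider is a bath sphere
  have hk₀mem : k₀ ∈ Set.range (fun c : Fin m => i.succAbove (j'.succAbove c)) := by
    rw [range_succAbove_succAbove]
    simp [hk₀i, hk₀j]
  obtain ⟨c, rfl⟩ := hk₀mem
  refine ⟨c, ?_⟩
  rcases hk₀ with hk | hk
  · exact Or.inl (cylRel_of_affine_contact hσ htraj hk.ne haT hTah haff_i (haff_b c) (mem_contactSet_of_collide hk))
  · exact Or.inr (cylRel_of_affine_contact hσ htraj hk.ne haT hTah haff_j (haff_b c) (mem_contactSet_of_collide hk))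

end Pathwise

end Summit.AtomisticToContinuum.HydrodynamicLimit.Theorems.EnskogCompensator

end
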